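import Summits.QuantumAdvantage.QuantumAdvantage.Theorems.CharDialGammaDialA
import Summits.QuantumAdvantage.QuantumAdvantage.Theorems.CharDialGammaDialC
import Summits.QuantumAdvantage.AdviceFreeQNC0.LinearSelections
import HarnessLib

/-!
# CharDial — THE SHEAR (part A): layer slices of a table-law class member drop one `𝔽_p`-degree

Tree twin, part A (§1–§3), of the decomp-qadv lens-5 g33 node `Theses/ShearDial.lean` (cell folder
`pub/decomp-qadv/decomp-qadv-lens-5/g33/`); lands `--kind proof --supports stmt-QuantumAdvantage-27205`; part B
(`CharDialShearDialB.lean`) concludes `TabAt p` at every odd prime and closes `FrobStructureLawOdd` (27205) and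
`FrobStructureLaw` (32603) BY NAME.  Namespace `Theorems.ShearDial`.

THE SHEAR (the lens's bridge between the two regimes).  FINITE/BASE RANGE = the sub-characteristic degrees `d ≤ p − 2`, where the tree's
junta law `SubChar.junta_of_hasDegF_subChar` (LANDED) says a Boolean function of `𝔽_p`-degree `≤ p − 2` is a `J₀(p)`-junta; ASYMPTOTIC REGIME =
the Frobenius notch `d = p − 1` (the table-law class: `f` depends on `X ⊇ R`, `|R| ≥ p − 1`, `f` is `R`-exchangeable, `HasDegF p f (p − 1)`,
constant top stratum `γ ≠ 0` on `X`).  BRIDGE = the shear `(v, z) ↦ (v, z − |v|)`: in the table form `f(u) = H(u|_{Rᶜ}, wt_R u)` (tree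
`IslandDial.exch_weight_form`) the SHEARED SLICE `g_z(v) := H(v|_{Rᶜ}, z − wt_{X∖R} v)` — `f` read along the LAYER `wt_X ≡ z` through
the free coordinates — has `𝔽_p`-degree `≤ p − 2` (§3 `hasDegF_shear`): one degree LOWER than `f`.  Reason (§1–§2): `1_{g_z}(v)` is the top
Möbius coefficient over the block of the product `1_f · [wt_X ≡ z]` (a binomial transform with a unique admissible residue, tree
`GammaDial.moeb_weight_top`), so its Möbius coefficients are those of that product at sets of size `≥ (p − 1) + |W|` (slice formula
`StrataDial.moeb_slice`); and the product has degree `≤ 2p − 3`, because `1_f = γ·[wt_X ≡ c] + (degree ≤ p − 2)` for ANY residue `c`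
(`TopConst`: every residue indicator of `wt_X` has the same top stratum `1`, §1 `moeb_resInd_top`) and for `c ≠ z` the two residue
indicators have product ZERO.  Hence every `g_z` is a `J₀(p)`-junta (base range), the `≤ p·J₀(p)` coordinates they read are the whole
exception set, and every other free coordinate `k` is a UNIT SHIFT of the table (`H(x + e_k, s) = H(x, s + 1)`), i.e. an exchange partner
of the block (tree `GammaDial.swapInv_of_unitShift`, `exch_union_of_unitShifts`): `Exch f (R ∪ (X ∖ R ∖ B))` with `|B| ≤ p·J₀(p)` —
this is `TabLaw p (p·J₀(p)) L` for every `L` (§4 `tabLaw_all`), so `TabAt p` (§4 `tabAt_all`), every odd prime, no case analysis on `γ`.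

Kernel-checked, no `sorry`; no instances, no notation; three plain `def`s (`resInd`, `rowPred`, `shear`).
-/

set_option autoImplicit false
set_option linter.dupNamespace false

namespace Summit.QuantumAdvantage.QuantumAdvantage.Theorems.ShearDial

open Finset
open Summit.QuantumAdvantage.AdviceFreeQNC0
open Literature.Computability.MetaComplexity Literature.Computability.MetaComplexity.Smolensky
open Summit.QuantumAdvantage.QuantumAdvantage.Theorems.IslandDial (Exch TopConst NormalForm ExchCoreAt ExchCoreOdd IslandAt IslandOdd
  exch_weight_form)
open Summit.QuantumAdvantage.QuantumAdvantage.Theorems.TableDial (TabLaw TabAt TabOdd SeedAt SeedOdd tabAt_iff_all)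
open Summit.QuantumAdvantage.QuantumAdvantage.Theorems.StrataDial (SwapInv exchCoreAt_iff_tabAt chi chi_eq_zero_of_card
  chi_eq_zero_of_not_subset moeb_slice seedAt_of_tabAt)
open Summit.QuantumAdvantage.QuantumAdvantage.Theorems.GammaDial (moeb_weight_top UnitShift swapInv_of_unitShift exch_union_of_unitShifts
  lawAt_of_tabAt islandAt_of_tabAt target_iff_tabOdd target_iff_exchCoreOdd)

/-! ### §1 Residue indicators of the weight on a block: degree `p − 1`, top stratum `1`, disjoint supports -/

section Residue

variable {p : ℕ} [hp : Fact p.Prime] {n : ℕ}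

/-- The `𝔽_p`-valued indicator of the residue class `c` of the weight on `X`: `u ↦ [wt_X u ≡ c (mod p)]`. -/
def resInd (p : ℕ) {n : ℕ} (X : Finset (Fin n)) (c : ZMod p) : CubeFn (ZMod p) n :=
  fun u => if ((SubChar.bw X u : ℕ) : ZMod p) = c then 1 else 0

/-- The weight on `X`, cast to `𝔽_p`, is the linear form with coefficients `1_X`. -/
theorem bw_cast_eq_form (X : Finset (Fin n)) (u : Fin n → Bool) :
    ((SubChar.bw X u : ℕ) : ZMod p) = ∑ i, (if u i then (if i ∈ X then (1 : ZMod p) else 0) else 0) := by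
  classical
  have h : ∀ i : Fin n, (if u i then (if i ∈ X then (1 : ZMod p) else 0) else 0)
      = if i ∈ X.filter (fun j => u j = true) then (1 : ZMod p) else 0 := by
    intro i
    by_cases hu : u i = true <;> by_cases hi : i ∈ X <;> simp [hu, hi, Finset.mem_filter]
  simp_rw [h]
  rw [Finset.sum_boole]
  unfold SubChar.bw
  congr 2
  ext i
  simp

/-- Residue indicators have degree `≤ p − 1` (a MOD-`p` test of a linear form, tree `hasDegF_linTest`). -/
theorem resInd_mem_lowDeg (X : Finset (Fin n)) (c : ZMod p) : resInd p X c ∈ lowDeg (ZMod p) n (p - 1) := by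
  have h := (SubLog.hasDegF_iff_indR p _ (p - 1)).1 (hasDegF_linTest (p := p) (fun i : Fin n => if i ∈ X then (1 : ZMod p) else 0) c)
  have e : resInd p X c = SubLog.indR (ZMod p)
      (fun u : Fin n → Bool => decide ((∑ i, (if u i then (if i ∈ X then (1 : ZMod p) else 0) else 0)) = c)) := by
    funext u
    simp only [resInd, SubLog.indR, decide_eq_true_eq, bw_cast_eq_form]
  rw [e]
  exact h

/-- TOP STRATUM: `μ_S([wt_X ≡ c]) = 1` at every `S ⊆ X` with `|S| = p − 1` (`p` odd) — the SAME for every residue `c`. -/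
theorem moeb_resInd_top (hp2 : p ≠ 2) {X S : Finset (Fin n)} (hS : S ⊆ X) (hc : S.card = p - 1) (c : ZMod p) :
    SubLog.moeb (resInd p X c) S = 1 := by
  have h := moeb_weight_top hp2 (fun s => decide (s = c)) hS hc
  have e : resInd p X c = fun u => if (fun s => decide (s = c)) ((SubChar.bw X u : ℕ) : ZMod p) then (1 : ZMod p) else 0 := by
    funext u
    simp only [resInd, decide_eq_true_eq]
  rw [e, h]
  unfold SubChar.resCount
  simp

omit hp in
/-- A residue indicator of the weight on `X` does not read coordinates off `X` … -/
theorem resInd_update_of_notMem {X : Finset (Fin n)} {i : Fin n} (hi : i ∉ X) (c : ZMod p) (u : Fin n → Bool) (b : Bool) :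
    resInd p X c (Function.update u i b) = resInd p X c u := by
  simp only [resInd, SubChar.bw_update_of_notMem hi]

/-- … so its Möbius coefficients vanish off `X` … -/
theorem moeb_resInd_eq_zero_of_not_subset {X S : Finset (Fin n)} (hS : ¬ S ⊆ X) (c : ZMod p) :
    SubLog.moeb (resInd p X c) S = 0 := by
  obtain ⟨i, hiS, hiX⟩ := Finset.not_subset.1 hS
  exact SubLog.moeb_eq_zero_of_indep (fun u b => resInd_update_of_notMem hiX c u b) hiS

/-- … and above the degree. -/
theorem moeb_resInd_eq_zero_of_card {X S : Finset (Fin n)} (hS : p ≤ S.card) (c : ZMod p) :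
    SubLog.moeb (resInd p X c) S = 0 :=
  SubLog.moeb_eq_zero_of_mem_lowDeg (resInd_mem_lowDeg X c) (by have := hp.out.one_lt; omega)

/-- Distinct residue classes are disjoint: `[wt_X ≡ c] · [wt_X ≡ c'] = 0` for `c ≠ c'`. -/
theorem resInd_mul_resInd_of_ne (X : Finset (Fin n)) {c c' : ZMod p} (hcc : c ≠ c') : resInd p X c * resInd p X c' = 0 := by
  funext u
  simp only [Pi.mul_apply, Pi.zero_apply, resInd]
  by_cases h : ((SubChar.bw X u : ℕ) : ZMod p) = c
  · rw [if_pos h, if_neg (fun h' => hcc (h.symm.trans h')), mul_zero]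
  · rw [if_neg h, zero_mul]

end Residue

/-! ### §2 A class member times a layer indicator has degree `≤ 2p − 3` -/

section Layer

variable {p : ℕ} [hp : Fact p.Prime] {n : ℕ} {f : (Fin n → Bool) → Bool} {X : Finset (Fin n)} {γ : ZMod p}

/-- `1_f − γ·[wt_X ≡ c]` has degree `≤ p − 2` for EVERY residue `c`: the top stratum `γ` of `f` on `X` (`TopConst`) is matched by
`γ` times the top stratum `1` of the residue indicator; above `p − 1` and off `X` both sides vanish. -/
theorem indR_sub_smul_resInd_mem_lowDeg (hp2 : p ≠ 2) (hdep : DependsOn f (↑X : Set (Fin n))) (hf : HasDegF p f (p - 1))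
    (htop : TopConst p f X γ) (c : ZMod p) :
    SubLog.indR (ZMod p) f - γ • resInd p X c ∈ lowDeg (ZMod p) n (p - 2) := by
  have hp1 : 1 < p := hp.out.one_lt
  refine SubLog.mem_lowDeg_of_moeb_eq_zero fun S hS => ?_
  rw [SubLog.moeb_sub, SubLog.moeb_smul]
  by_cases hSX : S ⊆ X
  · by_cases hc : S.card = p - 1
    · rw [htop S hSX hc, moeb_resInd_top hp2 hSX hc, mul_one, sub_self]
    · have hpS : p ≤ S.card := by omega
      rw [show SubLog.moeb (SubLog.indR (ZMod p) f) S = chi p f S from rfl, chi_eq_zero_of_card hf hpS,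
        moeb_resInd_eq_zero_of_card hpS, mul_zero, sub_self]
  · rw [show SubLog.moeb (SubLog.indR (ZMod p) f) S = chi p f S from rfl, chi_eq_zero_of_not_subset hdep hSX,
      moeb_resInd_eq_zero_of_not_subset hSX, mul_zero, sub_self]

/-- ★ `1_f · [wt_X ≡ z]` has degree `≤ (p − 2) + (p − 1) = 2p − 3`: write `1_f = γ·[wt_X ≡ c] + ℓ` with `c ≠ z` (`p ≥ 2`) and
`deg ℓ ≤ p − 2`; the residue indicators of `c ≠ z` have product zero, so the product is `ℓ · [wt_X ≡ z]`. -/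
theorem indR_mul_resInd_mem_lowDeg (hp2 : p ≠ 2) (hdep : DependsOn f (↑X : Set (Fin n))) (hf : HasDegF p f (p - 1))
    (htop : TopConst p f X γ) (z : ZMod p) :
    SubLog.indR (ZMod p) f * resInd p X z ∈ lowDeg (ZMod p) n (p - 2 + (p - 1)) := by
  have hc : z + 1 ≠ z := fun h => one_ne_zero (add_left_cancel (h.trans (add_zero z).symm))
  have e : SubLog.indR (ZMod p) f * resInd p X z = (SubLog.indR (ZMod p) f - γ • resInd p X (z + 1)) * resInd p X z := by
    rw [sub_mul, smul_mul_assoc, resInd_mul_resInd_of_ne X hc, smul_zero, sub_zero]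
  rw [e]
  exact mul_mem_lowDeg_add (indR_sub_smul_resInd_mem_lowDeg hp2 hdep hf htop (z + 1)) (resInd_mem_lowDeg X z)

end Layer

/-! ### §3 THE SHEAR: layer slices of a table drop one degree -/

section Shear

variable {p : ℕ} [hp : Fact p.Prime] {n : ℕ}

/-- THE SHEARED SLICE of the table `H` at residue `z`: `g_z(v) = H(v|_{Rᶜ}, z − wt_{X∖R} v)` — the class member `f(u) = H(u|_{Rᶜ}, wt_R u)`
read along the layer `wt_X u ≡ z` through its free coordinates `X ∖ R`. -/
def shear (X R : Finset (Fin n)) (H : (Fin n → Bool) → ZMod p → Bool) (z : ZMod p) : (Fin n → Bool) → Bool :=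
  fun v => H (JLin.proj (Finset.univ \ R) v) (z - ((SubChar.bw (X \ R) v : ℕ) : ZMod p))

/-- The ROW PREDICATE of the layer at base point `v`: residue `c` of the block weight is admissible iff `H(v|_{Rᶜ}, c)` holds and
`c + wt_{X∖R} v = z`. -/
def rowPred (X R : Finset (Fin n)) (H : (Fin n → Bool) → ZMod p → Bool) (z : ZMod p) (v : Fin n → Bool) : ZMod p → Bool :=
  fun c => H (JLin.proj (Finset.univ \ R) v) c && decide (c + ((SubChar.bw (X \ R) v : ℕ) : ZMod p) = z)

/-- The weight on `X ⊇ R` splits into the block weight and the free weight. -/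
theorem bw_eq_add_sdiff {X R : Finset (Fin n)} (hRX : R ⊆ X) (u : Fin n → Bool) :
    SubChar.bw X u = SubChar.bw R u + SubChar.bw (X \ R) u := by
  unfold SubChar.bw
  rw [← Finset.card_union_of_disjoint (Finset.disjoint_filter_filter Finset.disjoint_sdiff), ← Finset.filter_union,
    Finset.union_sdiff_of_subset hRX]

/-- Switching a `false` coordinate of `A` on raises the weight on `A` by one. -/
theorem bw_update_true {A : Finset (Fin n)} {k : Fin n} (hk : k ∈ A) {v : Fin n → Bool} (hv : v k = false) :
    SubChar.bw A (Function.update v k true) = SubChar.bw A v + 1 := by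
  classical
  unfold SubChar.bw
  have e : A.filter (fun i => Function.update v k true i = true) = insert k (A.filter fun i => v i = true) := by
    ext i
    by_cases hik : i = k
    · subst hik
      simp [hk]
    · simp [hik]
  rw [e, Finset.card_insert_of_notMem (by simp [hv])]

/-- The row predicate has exactly one candidate residue, `z − wt_{X∖R} v`; its residue count is the indicator of the sheared slice. -/
theorem resCount_rowPred (X R : Finset (Fin n)) (H : (Fin n → Bool) → ZMod p → Bool) (z : ZMod p) (v : Fin n → Bool) :
    SubChar.resCount (rowPred X R H z v) = SubLog.indR (ZMod p) (shear X R H z) v := by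
  unfold SubChar.resCount rowPred shear SubLog.indR
  rw [Finset.sum_eq_single (z - ((SubChar.bw (X \ R) v : ℕ) : ZMod p))]
  · simp
  · intro c _ hc
    have hne : ¬ (c + ((SubChar.bw (X \ R) v : ℕ) : ZMod p) = z) := fun h => hc (by rw [← h, add_sub_cancel_right])
    simp [hne]
  · intro h
    exact absurd (Finset.mem_univ _) h

variable {f : (Fin n → Bool) → Bool} {X R : Finset (Fin n)} {γ : ZMod p} {H : (Fin n → Bool) → ZMod p → Bool}

/-- Over the block `R` at base point `v`, the product `1_f · [wt_X ≡ z]` restricts to the weight indicator of the row predicate. -/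
theorem restr_indR_mul_resInd (hRX : R ⊆ X) (hH : ∀ u, f u = H (JLin.proj (Finset.univ \ R) u) ((SubChar.bw R u : ℕ) : ZMod p))
    (z : ZMod p) (v : Fin n → Bool) :
    SubLog.restr R v (SubLog.indR (ZMod p) f * resInd p X z) =
      fun u => if rowPred X R H z v ((SubChar.bw R u : ℕ) : ZMod p) then (1 : ZMod p) else 0 := by
  funext u
  show SubLog.indR (ZMod p) f (SubLog.merge R u v) * resInd p X z (SubLog.merge R u v) = _
  have h1 : JLin.proj (Finset.univ \ R) (SubLog.merge R u v) = JLin.proj (Finset.univ \ R) v := by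
    funext i
    unfold JLin.proj SubLog.merge
    by_cases hi : i ∈ Finset.univ \ R
    · rw [if_pos hi, if_pos hi, if_neg (Finset.mem_sdiff.1 hi).2]
    · rw [if_neg hi, if_neg hi]
  have h2 : SubChar.bw R (SubLog.merge R u v) = SubChar.bw R u :=
    SubChar.bw_congr fun i hi => by simp [SubLog.merge, hi]
  have h3 : SubChar.bw (X \ R) (SubLog.merge R u v) = SubChar.bw (X \ R) v :=
    SubChar.bw_congr fun i hi => by simp [SubLog.merge, (Finset.mem_sdiff.1 hi).2]
  have h4 : SubChar.bw X (SubLog.merge R u v) = SubChar.bw R u + SubChar.bw (X \ R) v := by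
    rw [bw_eq_add_sdiff hRX, h2, h3]
  simp only [SubLog.indR, resInd, rowPred, hH, h1, h2, h4, Nat.cast_add]
  rcases Bool.eq_false_or_eq_true (H (JLin.proj (Finset.univ \ R) v) ((SubChar.bw R u : ℕ) : ZMod p)) with hb | hb <;>
    by_cases h : ((SubChar.bw R u : ℕ) : ZMod p) + ((SubChar.bw (X \ R) v : ℕ) : ZMod p) = z <;> simp [hb, h]

/-- KEY IDENTITY: the indicator of the sheared slice at `v` is the top Möbius coefficient, over `p − 1` block coordinates `T ⊆ R`, of
the product `1_f · [wt_X ≡ z]` restricted to the block at base `v` (binomial transform with one admissible residue, tree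
`GammaDial.moeb_weight_top`). -/
theorem indR_shear_eq_moeb (hp2 : p ≠ 2) (hRX : R ⊆ X) {T : Finset (Fin n)} (hT : T ⊆ R) (hTc : T.card = p - 1)
    (hH : ∀ u, f u = H (JLin.proj (Finset.univ \ R) u) ((SubChar.bw R u : ℕ) : ZMod p)) (z : ZMod p) (v : Fin n → Bool) :
    SubLog.indR (ZMod p) (shear X R H z) v = SubLog.moeb (SubLog.restr R v (SubLog.indR (ZMod p) f * resInd p X z)) T := by
  rw [restr_indR_mul_resInd hRX hH z v, moeb_weight_top hp2 (rowPred X R H z v) hT hTc, resCount_rowPred]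

/-- ★ **THE SHEAR DROPS ONE DEGREE.**  For a table-law class member `f(u) = H(u|_{Rᶜ}, wt_R u)` (`R ⊆ X`, `|R| ≥ p − 1`, `f` a function of
`X` of degree `≤ p − 1` with constant top stratum `γ` on `X`) every sheared slice `g_z` has `𝔽_p`-degree `≤ p − 2`: by the key identity
and the slice formula, `1_{g_z} = Σ_{U ⊆ Rᶜ} μ_{T ∪ U}(1_f · [wt_X ≡ z]) · x_U`, and the coefficients with `|U| ≥ p − 1` sit at sets of
size `≥ 2p − 2 > 2p − 3 ≥ deg (1_f · [wt_X ≡ z])`. -/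
theorem hasDegF_shear (hp2 : p ≠ 2) (hRX : R ⊆ X) (hR : p - 1 ≤ R.card) (hdep : DependsOn f (↑X : Set (Fin n)))
    (hf : HasDegF p f (p - 1)) (htop : TopConst p f X γ)
    (hH : ∀ u, f u = H (JLin.proj (Finset.univ \ R) u) ((SubChar.bw R u : ℕ) : ZMod p)) (z : ZMod p) :
    HasDegF p (shear X R H z) (p - 2) := by
  classical
  obtain ⟨T, hT, hTc⟩ := Finset.exists_subset_card_eq hR
  have hdeg := indR_mul_resInd_mem_lowDeg hp2 hdep hf htop z
  have key : SubLog.indR (ZMod p) (shear X R H z) =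
      ∑ U ∈ (Finset.univ \ R).powerset, SubLog.moeb (SubLog.indR (ZMod p) f * resInd p X z) (T ∪ U) • mono (ZMod p) U := by
    funext v
    rw [indR_shear_eq_moeb hp2 hRX hT hTc hH z v, moeb_slice _ R v hT, Finset.sum_apply]
    simp only [Pi.smul_apply, smul_eq_mul, mono_apply, mul_ite, mul_one, mul_zero]
    rw [← Finset.sum_filter]
    refine Finset.sum_congr ?_ fun _ _ => rfl
    ext U
    simp only [Finset.mem_powerset, Finset.mem_filter, Finset.subset_iff]
    constructor
    · intro h
      exact ⟨fun i hi => (h hi).1, fun i hi => (h hi).2⟩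
    · intro h i hi
      exact ⟨h.1 hi, h.2 i hi⟩
  rw [SubLog.hasDegF_iff_indR, key]
  refine Submodule.sum_mem _ fun U hU => ?_
  by_cases hUc : U.card ≤ p - 2
  · exact Submodule.smul_mem _ _ (mono_mem_lowDeg hUc)
  · have hdisj : Disjoint T U :=
      Finset.disjoint_left.2 fun i hiT hiU => (Finset.mem_sdiff.1 (Finset.mem_powerset.1 hU hiU)).2 (hT hiT)
    have hcard : p - 2 + (p - 1) < (T ∪ U).card := by
      rw [Finset.card_union_of_disjoint hdisj, hTc]
      omega
    rw [SubLog.moeb_eq_zero_of_mem_lowDeg hdeg hcard, zero_smul]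
    exact Submodule.zero_mem _

end Shear

end Summit.QuantumAdvantage.QuantumAdvantage.Theorems.ShearDial
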